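import Summits.BirchSwinnertonDyer.BirchSwinnertonDyer.Theorems.SignedLowerHalvesSmallImageLowerHalfBothSignsRttCharRoadE1ResidualCharacterGlobal
import Summits.BirchSwinnertonDyer.BirchSwinnertonDyer.Theorems.SignedLowerHalvesSmallImageLowerHalfBothSignsRttEigenlineOfCartan
import HarnessLib

/-!
# Route `SignedLowerHalves`, crux L `SmallImageLowerHalfBothSigns` (item stmt-BirchSwinnertonDyer-23599), line `rtt_w3` v10 —
# brick E1-a, consumer form (ii′): `ρ̄ ⊗ k' |_{Γ_K} = L_θ ⊕ L_{θᶜ}`, any `c ∉ Γ_K` swapping the two lines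

Width seat `bsd-line-slh-p3-w3` g16 under LEAD `cruxlead-stmt-BirchSwinnertonDyer-23599` g6 (BRIEF §9.4, route D of E1-b); helper
`--supports stmt-BirchSwinnertonDyer-23599`; THEOREMS ONLY, no `sorry`; closes nothing; BSD / crux L / E1 / COUNT are NOT proved by this.

Sequel of `…RttCharRoadE1ResidualCharacterGlobal.lean` (★ `residualChar_eq_or_eq_conj`: `θ̄ = χ` or `θ̄ = χᶜ` on `Γ_K`) and of brick B3′
`…RttEigenlineOfCartan.lean` (★ `exists_eigenline_data_of_normalizer_unitGroup`: the `U`-eigenvector `v`, its partner `ρ(g₀)v` and the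
coordinates `α, β`). HERE the two are read together ON `Γ_K`, in the form the eigen-decomposition step (D2) of route D consumes:
★★ `exists_eigenlines_theta_thetaConj` — for the scalar extension `ρ` of `Φ ∘ ρ̄_{W,p}` to any field `k' ⊇ 𝔽_p` holding a root `lam` of
`X² − tr(y₀)X + det(y₀)`, any ring map `r : 𝒪_S → k'` killing `{‖x‖ < 1}` and any `c ∈ Γ_ℚ` with `Φρ̄(c) ∉ kˣ`, there is a basis
`(v₁, v₂)` of `k'²` with dual coordinates `(α, β)` such that `ρ(c)v₁ = v₂`, `ρ(c)v₂ = d·v₁` (`d ≠ 0`), `Γ_K` acts on `v₁` by the residual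
character `θ̄ : τ ↦ r(θ(τ)₀₀)` and on `v₂` by `θ̄ᶜ : τ ↦ θ̄(τ')` (`res τ' = c·res τ·c⁻¹`, such `τ'` exist), and every `g` with `Φρ̄(g) ∈ kˣ`
(resp. `∉ kˣ`) preserves (resp. swaps) the two lines `k'v₁`, `k'v₂`. Proof: B3′'s data `(χ, v, α, β)` at `g₀ := c`; `U := ρ̄⁻¹Φ⁻¹(kˣ) = res(Γ_K)`
has index `2`, so `c² ∈ U` and `χ(c⁻¹σc) = χ(cσc⁻¹)`; by `residualChar_eq_or_eq_conj` either `θ̄ = χ∘res` — take `(v, ρ(c)v)` — or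
`θ̄ = χᶜ∘res` — take `(ρ(c)v, ρ(c)²v = χ(c²)·v)` with coordinates `(β, χ(c²)⁻¹α)`. No Shapiro / `Coind` is used or delivered.

References: [Serre1972] §2.2 (normaliser of a non-split Cartan subgroup); [Rubin1991] §4 (motivation); BRIEF `Lines/rtt_w3-BRIEF-E1b-g6.md` §9.3 (D2), §9.4.
-/

set_option autoImplicit false
-- D-0017: single-problem summit, the namespace repeats the problem name by design.
set_option linter.dupNamespace false
noncomputable section

open scoped NumberField MatrixGroups Classical
open NumberField IsDedekindDomain Field Polynomial Matrix WeierstrassCurve Rat.HeightOneSpectrum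
  Literature.NumberTheory.GaloisRepresentations Literature.NumberTheory.EllipticCurves Literature.NumberTheory.LFunctions
  Literature.NumberTheory.LFunctions.NumberField
  Literature.NumberTheory.GaloisRepresentations.Serre1972
  Summit.BirchSwinnertonDyer.BirchSwinnertonDyer.Theorems.SmallImageLambdaLowerThreeNsThetaPartner
  Summit.BirchSwinnertonDyer.BirchSwinnertonDyer.Theorems.SmallImageRttShapiro

namespace Summit.BirchSwinnertonDyer.BirchSwinnertonDyer.Theorems.SmallImageRttCharRoad

section Abstract

universe u

variable {k' : Type u} [Field k'] {G : Type u} [Group G]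

/-- In B3′'s eigenline data (`α(w)v + β(w)ρ(g₀)v = w`, `α(v) = 1`, `α(ρ(g₀)v) = 0`, `v ≠ 0`) the second vector `ρ(g₀)v` is non-zero
and `β` is the dual coordinate: `β(v) = 0`, `β(ρ(g₀)v) = 1`. [folklore] -/
theorem eigenline_dual_coords (ρ : Representation k' G (Fin 2 → k')) (g₀ : G) (v : Fin 2 → k')
    (α β : (Fin 2 → k') →ₗ[k'] k') (hv0 : v ≠ 0) (hdec : ∀ w : Fin 2 → k', α w • v + β w • ρ g₀ v = w)
    (hαv : α v = 1) (hαg : α (ρ g₀ v) = 0) :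
    ρ g₀ v ≠ 0 ∧ β v = 0 ∧ β (ρ g₀ v) = 1 := by
  have hg0 : ρ g₀ v ≠ 0 := by
    intro h
    apply hv0
    have h1 : ρ (g₀⁻¹ * g₀) v = 0 := by rw [map_mul, Module.End.mul_apply, h, map_zero]
    rwa [inv_mul_cancel, map_one, Module.End.one_apply] at h1
  have hβv : β v = 0 := by
    have h1 := hdec v
    rw [hαv, one_smul, add_eq_left, smul_eq_zero] at h1
    exact h1.resolve_right hg0
  have hβg : β (ρ g₀ v) = 1 := by
    have h1 := hdec (ρ g₀ v)
    rw [hαg, zero_smul, zero_add] at h1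
    have h2 : (β (ρ g₀ v) - 1) • ρ g₀ v = 0 := by rw [sub_smul, one_smul, h1, sub_self]
    rw [smul_eq_zero] at h2
    exact sub_eq_zero.mp (h2.resolve_right hg0)
  exact ⟨hg0, hβv, hβg⟩

/-- For a `U`-eigenvector `v` with eigencharacter `χ` and any `c, σ` with `c⁻¹σc ∈ U`: `ρ(σ)(ρ(c)v) = χ(c⁻¹σc)·ρ(c)v`. [folklore] -/
theorem apply_partner_eq_smul (ρ : Representation k' G (Fin 2 → k')) {U : Subgroup G} (χ : U →* k'ˣ) (v : Fin 2 → k')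
    (hv : ∀ u : U, ρ (u : G) v = ((χ u : k'ˣ) : k') • v) (c σ : G) (hσ : c⁻¹ * σ * c ∈ U) :
    ρ σ (ρ c v) = ((χ ⟨c⁻¹ * σ * c, hσ⟩ : k'ˣ) : k') • ρ c v := by
  have h1 : σ * c = c * (c⁻¹ * σ * c) := by group
  rw [← Module.End.mul_apply, ← map_mul, h1, map_mul, Module.End.mul_apply]
  have h2 := hv ⟨c⁻¹ * σ * c, hσ⟩
  dsimp only at h2
  rw [h2, map_smul]

/-- If `c² ∈ U` then the eigencharacter is insensitive to the side of the conjugation: `χ(c⁻¹σc) = χ(cσc⁻¹)` (values in the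
commutative group `k'ˣ`; `cσc⁻¹ = c²·(c⁻¹σc)·c⁻²`). [folklore] -/
theorem char_conj_inv_eq_char_conj {U : Subgroup G} (χ : U →* k'ˣ) (c σ : G) (hcc : c * c ∈ U)
    (h₁ : c⁻¹ * σ * c ∈ U) (h₂ : c * σ * c⁻¹ ∈ U) :
    χ ⟨c⁻¹ * σ * c, h₁⟩ = χ ⟨c * σ * c⁻¹, h₂⟩ := by
  have h : (⟨c * σ * c⁻¹, h₂⟩ : U) = ⟨c * c, hcc⟩ * ⟨c⁻¹ * σ * c, h₁⟩ * (⟨c * c, hcc⟩ : U)⁻¹ := by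
    ext
    simp only [Subgroup.coe_mul, Subgroup.coe_inv]
    group
  rw [h, map_mul, map_mul, map_inv, mul_inv_cancel_comm]

end Abstract

section Curve

variable (W : WeierstrassCurve ℚ) [W.IsElliptic] [W.IsGloballyMinimal] (p : ℕ) [Fact p.Prime]
  (Φ : Multiplicative (AddAut (geomTorsion W p)) ≃* GL (Fin 2) (ZMod p))
  {k : Subalgebra (ZMod p) (Matrix (Fin 2) (Fin 2) (ZMod p))}
  (K : Type) [Field K] [NumberField K]

/-- ★★ **E1-a, consumer form (ii′): `ρ̄_{W,p} ⊗ k'` restricted to `Γ_K` is the direct sum of two lines on which `Γ_K` acts by `θ̄` and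
`θ̄ᶜ`, swapped by any `c ∉ Γ_K`.** Setting of `residualChar_eq_or_eq_conj` (module docstring of `…RttCharRoadE1ResidualCharacter`),
plus the clause `U ≤ res(Γ_K)` of the small-image datum, a root `lam ∈ k'` of `X² − tr(y₀)X + det(y₀)` and the scalar extension `ρ` of
`Φ ∘ ρ̄` to `k'` (its matrix formula `hρ`, e.g. from `exists_representation_map_mulVec`). Conclusion: vectors `v₁, v₂` and linear coordinates
`α, β` with `α(w)v₁ + β(w)v₂ = w`, `α(v₁) = β(v₂) = 1`, `α(v₂) = β(v₁) = 0`, `v₁, v₂ ≠ 0`; `ρ(c)v₁ = v₂` and `ρ(c)v₂ = d·v₁` with `d ≠ 0`;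
`ρ(res τ)v₁ = r(θ(τ)₀₀)·v₁`; `ρ(res τ)v₂ = r(θ(τ')₀₀)·v₂` whenever `res τ' = c·res τ·c⁻¹` (and such `τ'` exist for every `τ`); every `g`
with `Φρ̄(g) ∈ kˣ` preserves both lines and every `g` with `Φρ̄(g) ∉ kˣ` swaps them. [cite: Serre1972, §2.2] -/
theorem exists_eigenlines_theta_thetaConj (hk : IsField k) (h2k : Module.finrank (ZMod p) k = 2)
    (e₀ : geomTorsion W p ≃+ (Fin 2 → ZMod p))
    (he₀ : ∀ (g : Multiplicative (AddAut (geomTorsion W p))) (x : geomTorsion W p),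
      e₀ (Multiplicative.toAdd g x) = ((Φ g : GL (Fin 2) (ZMod p)) : Matrix (Fin 2) (Fin 2) (ZMod p)) *ᵥ e₀ x)
    (htr : letI : Module (ZMod p) (geomTorsion W p) := AddSubgroup.torsionBy.zmodModule
      ∀ g : Multiplicative (AddAut (geomTorsion W p)),
        Matrix.trace ((Φ g : GL (Fin 2) (ZMod p)) : Matrix (Fin 2) (Fin 2) (ZMod p)) =
          LinearMap.trace (ZMod p) (geomTorsion W p) ((Multiplicative.toAdd g).toAddMonoidHom.toZModLinearMap p))
    (hGN : (galoisRepTorsion W p).range.map Φ.toMonoidHom ≤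
      Subgroup.normalizer (Serre1972.unitGroup k : Set (GL (Fin 2) (ZMod p))))
    (hK2 : Module.finrank ℚ K = 2)
    (hU : ((Serre1972.unitGroup k).comap Φ.toMonoidHom).comap (galoisRepTorsion W p) ≤
      (absGaloisRestrict ℚ K).toMonoidHom.range)
    (hKU : ∀ τ : absoluteGaloisGroup K, Φ (galoisRepTorsion W p (absGaloisRestrict ℚ K τ)) ∈ Serre1972.unitGroup k)
    (𝔪 : Ideal (𝓞 K)) (h𝔪 : 𝔪 ≠ ⊥) (ψ : HeightOneSpectrum (𝓞 K) → ℂ) (e : PadicAlgCl p ≃+* ℂ)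
    (hneb : ∀ n : ℕ, Odd n → n.Coprime ((NumberField.discr K).natAbs * Ideal.absNorm 𝔪) →
      idealPow K ψ (Ideal.span {(n : 𝓞 K)}) = (jacobiSym (NumberField.discr K) n : ℂ) * (n : ℂ) ^ (2 - 1))
    (htrace : ∀ (ℓ : ℕ) [Fact ℓ.Prime], ℓ ≠ p → W.HasGoodReductionAtPrime ℓ →
      ‖e.symm (∑ᶠ (w : HeightOneSpectrum (𝓞 K)) (_ : Ideal.absNorm w.asIdeal = ℓ), ψ w) -
        (W.frobeniusTrace ℓ : PadicAlgCl p)‖ < 1)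
    {S : Set (PadicAlgCl p)} (θ : FramedGaloisRep K (padicCoeffIntegers S) 1)
    (hθ : ∀ w : HeightOneSpectrum (𝓞 K), (p : 𝓞 K) ∉ w.asIdeal → ¬ 𝔪 ≤ w.asIdeal →
      θ.IsUnramifiedAt w ∧ ∃ P : Polynomial (padicCoeffIntegers S),
        P.map (padicCoeffIntegers S).subtype = X - C (e.symm (ψ w)) ∧ θ.HasFrobCharpolyAt w P)
    {k' : Type} [Field k'] [Algebra (ZMod p) k'] (r : padicCoeffIntegers S →+* k')
    (hr : ∀ x : padicCoeffIntegers S, ‖(x : PadicAlgCl p)‖ < 1 → r x = 0)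
    {y₀ : Matrix (Fin 2) (Fin 2) (ZMod p)} (hy₀ : y₀ ∈ k) (hys : ∀ c : ZMod p, y₀ ≠ c • 1) (lam : k')
    (hlam : lam ^ 2 - algebraMap (ZMod p) k' y₀.trace * lam + algebraMap (ZMod p) k' y₀.det = 0)
    (ρ : Representation k' (absoluteGaloisGroup ℚ) (Fin 2 → k'))
    (hρ : ∀ (g : absoluteGaloisGroup ℚ) (w : Fin 2 → k'),
      ρ g w = ((Φ (galoisRepTorsion W p g) : GL (Fin 2) (ZMod p)) : Matrix (Fin 2) (Fin 2) (ZMod p)).map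
        (algebraMap (ZMod p) k') *ᵥ w)
    (c : absoluteGaloisGroup ℚ) (hc : Φ (galoisRepTorsion W p c) ∉ Serre1972.unitGroup k) :
    ∃ (v₁ v₂ : Fin 2 → k') (α β : (Fin 2 → k') →ₗ[k'] k') (d : k'),
      v₁ ≠ 0 ∧ v₂ ≠ 0 ∧ (∀ w : Fin 2 → k', α w • v₁ + β w • v₂ = w) ∧
      α v₁ = 1 ∧ α v₂ = 0 ∧ β v₁ = 0 ∧ β v₂ = 1 ∧
      ρ c v₁ = v₂ ∧ d ≠ 0 ∧ ρ c v₂ = d • v₁ ∧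
      (∀ τ : absoluteGaloisGroup K,
        ρ (absGaloisRestrict ℚ K τ) v₁ =
          r ((((θ τ : GL (Fin 1) (padicCoeffIntegers S)) : Matrix (Fin 1) (Fin 1) (padicCoeffIntegers S)) 0 0)) • v₁) ∧
      (∀ τ τ' : absoluteGaloisGroup K, absGaloisRestrict ℚ K τ' = c * absGaloisRestrict ℚ K τ * c⁻¹ →
        ρ (absGaloisRestrict ℚ K τ) v₂ =
          r ((((θ τ' : GL (Fin 1) (padicCoeffIntegers S)) : Matrix (Fin 1) (Fin 1) (padicCoeffIntegers S)) 0 0)) • v₂) ∧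
      (∀ τ : absoluteGaloisGroup K, ∃ τ' : absoluteGaloisGroup K,
        absGaloisRestrict ℚ K τ' = c * absGaloisRestrict ℚ K τ * c⁻¹) ∧
      (∀ g : absoluteGaloisGroup ℚ, Φ (galoisRepTorsion W p g) ∈ Serre1972.unitGroup k →
        (∃ a : k', ρ g v₁ = a • v₁) ∧ (∃ b : k', ρ g v₂ = b • v₂)) ∧
      (∀ g : absoluteGaloisGroup ℚ, Φ (galoisRepTorsion W p g) ∉ Serre1972.unitGroup k →
        (∃ a : k', ρ g v₁ = a • v₂) ∧ (∃ b : k', ρ g v₂ = b • v₁)) := by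
  have hp : p.Prime := Fact.out
  -- the subgroup `U = ρ̄⁻¹Φ⁻¹(kˣ)` and its index
  set U : Subgroup (absoluteGaloisGroup ℚ) :=
    (Serre1972.unitGroup k).comap (Φ.toMonoidHom.comp (galoisRepTorsion W p)) with hUdef
  have hmemU : ∀ g : absoluteGaloisGroup ℚ, g ∈ U ↔ Φ (galoisRepTorsion W p g) ∈ Serre1972.unitGroup k :=
    fun g => Iff.rfl
  haveI : FiniteDimensional ℚ K := Module.finite_of_finrank_eq_succ hK2
  have hUeq : U = (absGaloisRestrict ℚ K).toMonoidHom.range := by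
    refine le_antisymm (fun g hg => hU (by rw [Subgroup.comap_comap]; exact hg)) ?_
    rintro g ⟨τ, rfl⟩
    exact hKU τ
  have hidx : U.index = 2 := by
    rw [hUeq]
    exact (index_range_absGaloisRestrict_eq_finrank ℚ K).trans hK2
  have hcU : c ∉ U := hc
  have hccU : c * c ∈ U := Subgroup.mul_self_mem_of_index_two hidx c
  have hconjU : ∀ (g : absoluteGaloisGroup ℚ) {σ : absoluteGaloisGroup ℚ}, σ ∈ U → g * σ * g⁻¹ ∈ U :=
    fun g σ hσ => conj_mem_of_mem W p Φ hGN g hσ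
  have hconjU' : ∀ (g : absoluteGaloisGroup ℚ) {σ : absoluteGaloisGroup ℚ}, σ ∈ U → g⁻¹ * σ * g ∈ U :=
    fun g σ hσ => by simpa only [inv_inv] using hconjU g⁻¹ hσ
  have hmulU : ∀ {g h : absoluteGaloisGroup ℚ}, g ∉ U → h ∉ U → g * h ∈ U := fun hg hh =>
    (Subgroup.mul_mem_iff_of_index_two hidx).2 (iff_of_false hg hh)
  -- B3′'s eigenline data at `g₀ := c`
  have hN' : ∀ g : absoluteGaloisGroup ℚ, (Φ.toMonoidHom.comp (galoisRepTorsion W p)) g ∈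
      Subgroup.normalizer (Serre1972.unitGroup k : Set (GL (Fin 2) (ZMod p))) :=
    fun g => hGN ⟨galoisRepTorsion W p g, ⟨g, rfl⟩, rfl⟩
  have hdisc : y₀.trace ^ 2 - 4 * y₀.det ≠ 0 := trace_sq_sub_four_det_ne_zero_of_isField hk hy₀ hys
  obtain ⟨χ, v, α, β, hv0, -, hv, hdec, hαv, hαg, hχ⟩ :=
    exists_eigenline_data_of_normalizer_unitGroup hk h2k hy₀ hys hdisc lam hlam
      (Φ.toMonoidHom.comp (galoisRepTorsion W p)) hN' c hc ρ (fun g w => hρ g w)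
  obtain ⟨hcv0, hβv, hβg⟩ := eigenline_dual_coords ρ c v α β hv0 hdec hαv hαg
  -- `d = χ(c²)`
  set d : k' := ((χ ⟨c * c, hccU⟩ : k'ˣ) : k') with hd
  have hd0 : d ≠ 0 := (χ ⟨c * c, hccU⟩).ne_zero
  have hccv : ρ c (ρ c v) = d • v := by
    rw [← Module.End.mul_apply, ← map_mul]
    exact hv ⟨c * c, hccU⟩
  -- the partner line: `ρ(σ)(ρ(c)v) = χ(cσc⁻¹)·ρ(c)v` for `σ ∈ U`
  have hpartner : ∀ {σ : absoluteGaloisGroup ℚ} (hσ : σ ∈ U),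
      ρ σ (ρ c v) = ((χ ⟨c * σ * c⁻¹, hconjU c hσ⟩ : k'ˣ) : k') • ρ c v := fun {σ} hσ => by
    rw [apply_partner_eq_smul ρ χ v hv c σ (hconjU' c hσ), char_conj_inv_eq_char_conj χ c σ hccU]
  -- existence of `τ'`
  have hτ' : ∀ τ : absoluteGaloisGroup K, ∃ τ' : absoluteGaloisGroup K,
      absGaloisRestrict ℚ K τ' = c * absGaloisRestrict ℚ K τ * c⁻¹ := fun τ => by
    have h1 : c * absGaloisRestrict ℚ K τ * c⁻¹ ∈ U := hconjU c (hKU τ)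
    rw [hUeq] at h1
    obtain ⟨τ', hτ'⟩ := h1
    exact ⟨τ', hτ'⟩
  -- line stability for `g ∈ U` / swapping for `g ∉ U`, on the pair `(v, ρ(c)v)`
  have hstabv : ∀ g : absoluteGaloisGroup ℚ, g ∈ U → ∃ a : k', ρ g v = a • v :=
    fun g hg => ⟨_, hv ⟨g, hg⟩⟩
  have hstabcv : ∀ g : absoluteGaloisGroup ℚ, g ∈ U → ∃ b : k', ρ g (ρ c v) = b • ρ c v :=
    fun g hg => ⟨_, hpartner hg⟩
  have hswapv : ∀ g : absoluteGaloisGroup ℚ, g ∉ U → ∃ a : k', ρ g v = a • ρ c v := fun g hg => by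
    have h1 : c⁻¹ * g ∈ U := hmulU (fun h => hcU ((Subgroup.inv_mem_iff U).1 h)) hg
    refine ⟨((χ ⟨c⁻¹ * g, h1⟩ : k'ˣ) : k'), ?_⟩
    have h2 : g = c * (c⁻¹ * g) := by group
    have h3 := hv ⟨c⁻¹ * g, h1⟩
    dsimp only at h3
    conv_lhs => rw [h2, map_mul, Module.End.mul_apply, h3, map_smul]
  have hswapcv : ∀ g : absoluteGaloisGroup ℚ, g ∉ U → ∃ b : k', ρ g (ρ c v) = b • v := fun g hg => by
    refine ⟨((χ ⟨g * c, hmulU hg hcU⟩ : k'ˣ) : k'), ?_⟩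
    rw [← Module.End.mul_apply, ← map_mul]
    exact hv ⟨g * c, hmulU hg hcU⟩
  -- E1-a: `θ̄ = χ ∘ res` or `θ̄ = χᶜ ∘ res`
  rcases residualChar_eq_or_eq_conj W p Φ K hk h2k e₀ he₀ htr hGN hK2 hKU 𝔪 h𝔪 ψ e hneb htrace θ hθ r hr hy₀ hys lam
      χ hχ c hc with hA | hB
  · -- Case A: `θ̄ = χ`: lines `(v, ρ(c)v)`
    refine ⟨v, ρ c v, α, β, d, hv0, hcv0, hdec, hαv, hαg, hβv, hβg, rfl, hd0, hccv, fun τ => ?_, fun τ τ' hττ' => ?_, hτ',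
      fun g hg => ⟨hstabv g hg, hstabcv g hg⟩, fun g hg => ⟨hswapv g hg, hswapcv g hg⟩⟩
    · rw [hA τ]; exact hv ⟨_, hKU τ⟩
    · rw [hA τ', hpartner (hKU τ)]
      congr 3
      exact Subtype.ext hττ'.symm
  · -- Case B: `θ̄ = χᶜ`: lines `(ρ(c)v, ρ(c)²v = d·v)` with coordinates `(β, d⁻¹α)`
    refine ⟨ρ c v, ρ c (ρ c v), β, d⁻¹ • α, d, hcv0, ?_, fun w => ?_, hβg, ?_, ?_, ?_, rfl, hd0, ?_, fun τ => ?_,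
      fun τ τ' hττ' => ?_, hτ', fun g hg => ⟨hstabcv g hg, ?_⟩, fun g hg => ⟨?_, ?_⟩⟩
    · rw [hccv]; exact smul_ne_zero hd0 hv0
    · rw [hccv, LinearMap.smul_apply, smul_eq_mul, smul_smul, mul_right_comm, inv_mul_cancel₀ hd0, one_mul, add_comm]
      exact hdec w
    · rw [hccv, map_smul, hβv, smul_zero]
    · rw [LinearMap.smul_apply, hαg, smul_zero]
    · rw [hccv, LinearMap.smul_apply, map_smul, hαv, smul_eq_mul, smul_eq_mul, mul_one, inv_mul_cancel₀ hd0]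
    · rw [hccv, map_smul]
    · rw [hB τ]; exact hpartner (hKU τ)
    · have h1 : c * absGaloisRestrict ℚ K τ * c⁻¹ ∈ U := hconjU c (hKU τ)
      have h2 := hv ⟨absGaloisRestrict ℚ K τ, hKU τ⟩
      dsimp only at h2
      rw [hB τ', hccv, map_smul, h2, smul_comm]
      congr 2
      have h3 : c⁻¹ * (c * absGaloisRestrict ℚ K τ * c⁻¹) * c = absGaloisRestrict ℚ K τ := by group
      have h3U : c⁻¹ * (c * absGaloisRestrict ℚ K τ * c⁻¹) * c ∈ U := by rw [h3]; exact hKU τ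
      have h4 := char_conj_inv_eq_char_conj χ c (c * absGaloisRestrict ℚ K τ * c⁻¹) hccU h3U (hconjU c h1)
      have h5 : (⟨c⁻¹ * (c * absGaloisRestrict ℚ K τ * c⁻¹) * c, h3U⟩ : U) = ⟨absGaloisRestrict ℚ K τ, hKU τ⟩ :=
        Subtype.ext h3
      rw [h5] at h4
      rw [h4]
      congr 1
      exact Subtype.ext (show c * (c * absGaloisRestrict ℚ K τ * c⁻¹) * c⁻¹ = c * absGaloisRestrict ℚ K τ' * c⁻¹ by
        rw [hττ'])
    · obtain ⟨a, ha⟩ := hstabv g hg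
      exact ⟨a, by rw [hccv, map_smul, ha, smul_comm]⟩
    · obtain ⟨b, hb⟩ := hswapcv g hg
      exact ⟨b * d⁻¹, by rw [hb, hccv, mul_smul, smul_smul d⁻¹ d, inv_mul_cancel₀ hd0, one_smul]⟩
    · obtain ⟨a, ha⟩ := hswapv g hg
      exact ⟨d * a, by rw [hccv, map_smul, ha, mul_smul]⟩

end Curve

end Summit.BirchSwinnertonDyer.BirchSwinnertonDyer.Theorems.SmallImageRttCharRoad

end
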